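import Summits.QuantumFields.BalabanUV.T4Continuum.Spine.NE9.TowerCarriersKing
import Literature.MathematicalPhysics.QuantumFieldTheory.Balaban1983to89.T4Crossover

/-!
# T⁴ programme, spine estimate NE9 — KING'S QUALITATIVE E-BRACKET THROUGH THE LIVE NODE-U4′ CROSSOVER: the scale profile
# `b_j → 0` survives the ENTROPY `Λ^{K−j}` of scale-`j` domains per unit volume by dominated convergence against the PRINTED
# size branch, at no rate and with no summability — census item C39 of cell `pub-balaban-gaps`, seat ne9 (gen 11)

Cell `pub-balaban-gaps` (YM blitz G2, seat ne9, unit `pub-balaban-gaps-ne9-g11`; record `run/shared/lean/pub/pub-balaban-gaps/ne/NE9.md`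
§5 row C39).  Summits-side bookkeeping over the tree's node-U4′ vocabulary (`T4Crossover`: the crossover sums
`Σ_{j+n=K} min(SIZE, RATE_j·Λⁿ)`, `crossoverDelta`, `Step.Discrete031`), node U6 in King's organisation (this seat's `DirectPairingCauchy`),
and the E-side profile of the tower of carriers (this seat's `TowerCarriersKing`).  NO definition; nothing of Bałaban's asserted.

WHY.  Gens 6–10 of this seat (census C30–C38e) showed that in KING's organisation of node U6 (runs `K` and `K + n` compared DIRECTLY,
remainders `→ 0` uniformly in `n`, [King1986] Thm 3.4) the E-side owes node U3 → U6 only a QUALITATIVE scale profile `b_j → 0` dominating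
the direct bracket (`TowerCarriersKing.exists_profile_carriers`: tower-NE5 + prefix dependence + separate uniform continuity per scale + the
(1.18) bound).  But every King END so far (`DirectPairingCauchy.cauchy_of_kingShape`, `TowerCarriersKing.king_U6_of_carriers`, `…_of_margin`,
`…_of_propagation`, …) handed that profile to node U6 through `T4CauchySum.delta E ρ inj K = E·Σ_{j+n=K} inj_{K,j}·ρⁿ` — the transported total
of T4-DAG v0's node U4 ∕ NE6 («the irrelevance contraction `ρ = L^{−β}` applied to the DIFFERENCE of the two runs' terms»), which the cell
RETIRED in favour of node U4′ (`T4Crossover` §4: "the crossover majorant in place of the retired transported total `T4CauchySum.delta`").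
The LIVE spine books the scale-`j` E-terms per unit final volume as `min(SIZE, RATE)`: SIZE = the printed one-run bound [Balaban1988Convergent]
Thm 2 (2.43) p. 263 (contraction `a = L^{−β}` per remaining scale `n = K − j`, constant `E₁`; R-terms: (2.44), `R₁ g_j^{κ₀}`, NOT contracted),
RATE = the two-run η-rate `θ^j` TIMES THE MULTIPLICITY `Λⁿ` (`Λ = L⁴`) of scale-`j` domains per unit volume (`T4RecentScale.Multiplicity`,
`sum_rate_le_crossoverShape`; `T4Crossover.sum_min_pow_le_crossover`, `summable_crossoverDelta`).  In King's currency `θ^j ↦ b_j`, a profile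
that merely TENDS TO ZERO.  QUESTION (C39): does `b_j → 0` survive the entropy `Λⁿ` — i.e. does `Σ_{j+n=K} min(E₁aⁿ, b_j Λⁿ) → 0` — at what
printed price, and is the consecutive socket's `Summable` recovered?

ANSWER (kernel, this file).
* §1 `tendsto_sum_antidiagonal_of_dominated`: dominated convergence on the antidiagonal, indexed by the number `n` of remaining scales
  (Mathlib's Tannery theorem `tendsto_tsum_of_dominated_convergence` BY NAME): a `K`-uniform summable majorant in `n` + each fixed-`n` term
  `→ 0` ⇒ the sum `→ 0`.
* §2 `tendsto_sum_min_of_profile`: the master form — ANY nonnegative size family dominated (in the `min`) by a summable `c n` for `n ≥ 1`,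
  against `b_j Λⁿ` with `b ≥ 0`, `b → 0`, `Λ ≥ 0` ARBITRARY: `Σ_{j+n=K} min(s, b_jΛⁿ) → 0`.  The size branch is the dominating sequence; the
  rate branch kills each fixed-`n` term (`b_{K−n}Λⁿ → 0`); the `n = 0` term is `≤ b_K`.
* §3 `tendsto_crossoverE_of_profile`: the E-branch `Σ_{j+n=K} min(E₁aⁿ, b_jΛⁿ) → 0` (`0 ≤ a < 1`, `E₁ ≥ 0`) — King's replacement of
  `T4Crossover.sum_min_pow_le_crossover` ∕ `summable_sum_min_pow`; NO crossover exponent, NO rate, `Λ` unrestricted.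
* §4 `tendsto_crossoverR_of_profile`: the R-branch `Σ_{j+n=K} min(R₁ g_j^{κ₀}, b_jΛⁿ) → 0` under the LOWER half of (0.31)
  (`Step.Discrete031`, as in `T4Crossover.min_coupling_le`) with `κ₀ > 2` (dominating p-series `R₁(b₀n)^{−κ₀∕2}`; the consecutive count
  `sum_min_coupling_le` needs `κ₀ > 4`).
* §5 `tendsto_kingCrossover` ∕ `king_U6_of_crossover`: the King crossover majorant `E-branch + R-branch + w_K` with `w_K → 0` tends to zero, and
  King's matching shape with that remainder gives `CauchySeq genFun` + uniform convergence on the `l₀`-ball (`DirectPairingCauchy` BY NAME) —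
  the node-U4′ analogue of `T4Crossover.cauchySum_of_crossover` with `Summable` replaced by `→ 0` throughout; `king_crossover_of_carriers`:
  the E-side profile of `TowerCarriersKing.king_U6_of_carriers` feeds it BY NAME (the retired `delta` clause of that END replaced by the live
  crossover clause).
* §6 TWO-SIDED.  `rateOnly_not_tendsto`: WITHOUT the size branch the entropy wins — `b_j = 1∕(j+1) → 0`, `Λ = 2`: `Σ_{j+n=K} b_jΛⁿ ≥ 2^K`;
  so the printed SIZE bound (2.43)∕(2.44) ([III] Thm 2 — a T-row, displayed, never discharged here) is LOAD-BEARING for King's currency at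
  node U4′ exactly as it is for the consecutive currency (nothing NEW is owed).  `crossover_not_summable`: with the same profile the King
  crossover sum is `≥ 1∕(K+1)`, NOT summable over `K` — the consecutive socket (`T4Crossover.summable_crossoverDelta` ⇒
  `T4CauchySum.cauchySeq_genFun`) is NOT recovered from `b → 0`, while King's END §5 fires (consistent with C38e `DirectPairingApexSharp.alt_strict`).
  `profile_le_crossover`: the sum inherits no rate (`≥ min(E₁, b_K)`).

VERDICT FOR THE ROW (census C39).  King's qualitative currency passes node U4′: the E-side's debt to node U3 → U6 stays «a scale profile
`b_j → 0`» (§17 rows 1–5 of `NE9.md`, no modulus, no constant, no rate, no `Summable`) ALSO against the multiplicity `Λ^{K−j}`, the price being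
the PRINTED one-run size bounds (2.43)∕(2.44) as the dominating sequence — the same T-row the consecutive spine consumes; the retired node-U4
transport of differences (NE6) is no longer used by the King route; in the per-term budget of node U5 (`DirectPairingApexBudget.cauchy_of_reindexedBudget`)
the recent radius `r_K` produced by the crossover therefore `→ 0` (its `hr`), not `Σ < ∞`.  CLASSIFICATION OF NE9 UNCHANGED: WORK-bound (W1 = the
one-step renormalization transformation as a Lean object; instance 0∕1).

HONEST FRAMING: bookkeeping for rung (B)+1 on ONE FIXED finite four-torus; elementary real analysis on hypothesis SHAPES; tower-NE5 is the cell's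
estimate NE5 (NOT PRINTED, NOT PROVED); (2.43)∕(2.44) are Bałaban's printed Theorem 2 of [III], displayed as the SHAPE of a size branch and NOT
proved here; NE9 NOT PRINTED ∕ NOT PROVED; spine PROVED 0∕9 unchanged; NOT UV stability, NOT the continuum limit, NOT infinite volume, NOT a mass
gap, NOT Clay.  HONEST DEPENDENCY: continuum YM on T⁴ ⇐ BetaPertH ∧ nine spine estimates (0∕9 proved); BetaPertH ⇐ (D1) ∧ (D4) ∧ CAP+tail.

References (TYPES only): [Balaban1988Convergent] = T. Bałaban, Commun. Math. Phys. **119** (1988) 243–285, Thm 2 (2.43)–(2.44) p. 263, (2.31)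
p. 260; [Balaban1987RG1] = T. Bałaban, Commun. Math. Phys. **109** (1987) 249–301, (0.31) p. 259; [King1986] = C. King, Commun. Math. Phys. **102**
(1986) 649–677, Thm 3.4 (3.9) p. 656, p. 657.
-/

namespace Summit.QuantumFields.BalabanUV.T4Continuum.NE9.DirectPairingCrossover

open scoped BigOperators
open Finset Filter Topology
open Literature.MathematicalPhysics.QuantumFieldTheory.Balaban1983to89
open Literature.MathematicalPhysics.QuantumFieldTheory.Balaban1983to89.T4CouplingAnalyticity (BoxWindow)
open T4CauchySum (genFun genFunLim)
open Summit.QuantumFields.BalabanUV.T4Continuum.NE9.TowerCarriers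
open Summit.QuantumFields.BalabanUV.T4Continuum.NE9.TowerCarriersBox (TowerNE5On)
open Summit.QuantumFields.BalabanUV.T4Continuum.NE9.DirectPairingCauchy
  (cauchySeq_genFun_of_unif tendstoUniformlyOn_genFun_of_unif)

/-! ## §1 Dominated convergence on the antidiagonal (Tannery, by name) -/

/-- **TANNERY ON THE ANTIDIAGONAL.**  A family `u K (j, n)` on `j + n = K` (`j` = scale of injection, `n` = remaining scales) with a
`K`-UNIFORM summable majorant in the number of remaining scales, `|u K (j, n)| ≤ c n`, whose every fixed-`n` term tends to zero,
`u K (K − n, n) → 0` (`K → ∞`), has `Σ_{j+n=K} u K (j, n) → 0`.  Mathlib's `tendsto_tsum_of_dominated_convergence` on the extension by zero.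
[folklore] -/
theorem tendsto_sum_antidiagonal_of_dominated {u : ℕ → ℕ × ℕ → ℝ} {c : ℕ → ℝ} (hcs : Summable c)
    (hdom : ∀ K : ℕ, ∀ p ∈ antidiagonal K, |u K p| ≤ c p.2)
    (hlim : ∀ n : ℕ, Tendsto (fun K => u K (K - n, n)) atTop (𝓝 0)) :
    Tendsto (fun K => ∑ p ∈ antidiagonal K, u K p) atTop (𝓝 0) := by
  -- the extension by zero, indexed by the number of remaining scales
  set g : ℕ → ℕ → ℝ := fun K n => if n ≤ K then u K (K - n, n) else 0 with hg
  have hc0 : ∀ n, 0 ≤ c n := fun n =>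
    (abs_nonneg _).trans (hdom n (0, n) (by simp [HasAntidiagonal.mem_antidiagonal]))
  have hsum : ∀ K, ∑ p ∈ antidiagonal K, u K p = ∑' n, g K n := by
    intro K
    have h1 : ∑ p ∈ antidiagonal K, u K p = ∑ n ∈ range (K + 1), g K n := by
      rw [← Nat.sum_antidiagonal_swap, Nat.sum_antidiagonal_eq_sum_range_succ_mk]
      refine sum_congr rfl fun n hn => ?_
      have hnK : n ≤ K := Nat.lt_succ_iff.mp (mem_range.mp hn)
      simp only [hg, Prod.swap_prod_mk, if_pos hnK]
    rw [h1]
    refine (tsum_eq_sum fun n hn => ?_).symm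
    have hnK : ¬ n ≤ K := fun h => hn (mem_range.mpr (Nat.lt_succ_of_le h))
    simp only [hg, if_neg hnK]
  have hfun : (fun K => ∑ p ∈ antidiagonal K, u K p) = fun K => ∑' n, g K n := funext hsum
  rw [hfun]
  have h := tendsto_tsum_of_dominated_convergence (𝓕 := atTop) (f := g) (g := fun _ : ℕ => (0 : ℝ))
    (bound := c) hcs ?_ ?_
  · simpa using h
  · intro n
    refine (hlim n).congr' ?_
    filter_upwards [eventually_ge_atTop n] with K hK
    simp only [hg, if_pos hK]
  · refine Eventually.of_forall fun K n => ?_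
    by_cases hnK : n ≤ K
    · have hp : (K - n, n) ∈ antidiagonal K := by
        rw [HasAntidiagonal.mem_antidiagonal]
        exact Nat.sub_add_cancel hnK
      simpa only [hg, if_pos hnK, Real.norm_eq_abs] using hdom K (K - n, n) hp
    · simpa only [hg, if_neg hnK, norm_zero] using hc0 n

/-! ## §2 The master form: a dominated size branch against a qualitative rate branch times the multiplicity -/

/-- **`Σ_{j+n=K} min(SIZE, b_j·Λⁿ) → 0` FOR EVERY PROFILE `b_j → 0`.**  A nonnegative size family `s K (j, n)` whose `min` with the rate branch
is dominated for `n ≥ 1` by a summable `c n ≥ 0` (the PRINTED one-run sizes: `E₁aⁿ`, `R₁ g_j^{κ₀}`), a multiplicity base `Λ ≥ 0` (ANY — `Λ = L⁴`),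
and a nonnegative scale profile `b_j → 0` (King's qualitative E-side currency): the crossover sum tends to zero.  Dominating sequence = the size
branch (+ `sup b` at `n = 0`); termwise limit = the rate branch `b_{K−n}Λⁿ → 0` at fixed `n`.  NO rate, NO summability of `b`, NO crossover
exponent. [folklore] -/
theorem tendsto_sum_min_of_profile {s : ℕ → ℕ × ℕ → ℝ} {c : ℕ → ℝ} {Λ : ℝ} {b : ℕ → ℝ}
    (hs0 : ∀ K : ℕ, ∀ p ∈ antidiagonal K, 0 ≤ s K p) (hc0 : ∀ n, 0 ≤ c n) (hcs : Summable c)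
    (hdom : ∀ K : ℕ, ∀ p ∈ antidiagonal K, 1 ≤ p.2 → min (s K p) (b p.1 * Λ ^ p.2) ≤ c p.2)
    (hΛ : 0 ≤ Λ) (hb0 : ∀ j, 0 ≤ b j) (hb : Tendsto b atTop (𝓝 0)) :
    Tendsto (fun K => ∑ p ∈ antidiagonal K, min (s K p) (b p.1 * Λ ^ p.2)) atTop (𝓝 0) := by
  -- `b` is bounded by some `B ≥ 0`
  obtain ⟨B, hB⟩ := hb.bddAbove_range
  have hbB : ∀ j, b j ≤ B := fun j => hB ⟨j, rfl⟩
  have hB0 : 0 ≤ B := (hb0 0).trans (hbB 0)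
  have hmin0 : ∀ K : ℕ, ∀ p ∈ antidiagonal K, 0 ≤ min (s K p) (b p.1 * Λ ^ p.2) := fun K p hp =>
    le_min (hs0 K p hp) (mul_nonneg (hb0 _) (pow_nonneg hΛ _))
  refine tendsto_sum_antidiagonal_of_dominated (c := fun n => c n + if n = 0 then B else 0) ?_ ?_ ?_
  · exact hcs.add (summable_of_ne_finset_zero (s := {0}) fun n hn => if_neg (by simpa using hn))
  · intro K p hp
    rw [abs_of_nonneg (hmin0 K p hp)]
    rcases Nat.eq_zero_or_pos p.2 with h0 | hpos
    · -- no remaining scale: the rate branch is `b_K ≤ B`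
      have h1 : min (s K p) (b p.1 * Λ ^ p.2) ≤ B := by
        rw [h0, pow_zero, mul_one]
        exact (min_le_right _ _).trans (hbB _)
      rw [if_pos h0]
      linarith [hc0 p.2]
    · have h1 := hdom K p hp hpos
      have h2 : (0 : ℝ) ≤ if p.2 = 0 then B else 0 := by split_ifs <;> simp [hB0]
      linarith
  · intro n
    have hup : Tendsto (fun K => b (K - n) * Λ ^ n) atTop (𝓝 0) := by
      simpa using (hb.comp (tendsto_sub_atTop_nat n)).mul_const (Λ ^ n)
    refine squeeze_zero' ?_ (Eventually.of_forall fun K => min_le_right _ _) hup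
    filter_upwards [eventually_ge_atTop n] with K hK
    have hp : (K - n, n) ∈ antidiagonal K := by
      rw [HasAntidiagonal.mem_antidiagonal]
      exact Nat.sub_add_cancel hK
    exact hmin0 K _ hp

/-! ## §3 The E-branch: printed contraction `aⁿ` per remaining scale against `b_j·Λⁿ` -/

/-- **KING's CROSSOVER, E-BRANCH.**  `0 ≤ E₁`, `0 ≤ a < 1` (the printed (2.43): `a = L^{−β}`), `Λ ≥ 0` arbitrary (`Λ = L⁴`), `b ≥ 0`, `b → 0` ⇒
`Σ_{j+n=K} min(E₁aⁿ, b_jΛⁿ) → 0`.  Compare the consecutive currency `T4Crossover.sum_min_pow_le_crossover` ∕ `summable_sum_min_pow` (`b_j = θ^j`,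
crossover exponent, `Summable`). [cite: Balaban1988Convergent, Thm 2 (2.43) p.263] [folklore] -/
theorem tendsto_crossoverE_of_profile {E₁ a Λ : ℝ} {b : ℕ → ℝ} (hE₁ : 0 ≤ E₁) (ha0 : 0 ≤ a) (ha1 : a < 1) (hΛ : 0 ≤ Λ)
    (hb0 : ∀ j, 0 ≤ b j) (hb : Tendsto b atTop (𝓝 0)) :
    Tendsto (fun K => ∑ p ∈ antidiagonal K, min (E₁ * a ^ p.2) (b p.1 * Λ ^ p.2)) atTop (𝓝 0) :=
  tendsto_sum_min_of_profile (s := fun _ p => E₁ * a ^ p.2) (c := fun n => E₁ * a ^ n)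
    (fun _ _ _ => mul_nonneg hE₁ (pow_nonneg ha0 _)) (fun n => mul_nonneg hE₁ (pow_nonneg ha0 n))
    ((summable_geometric_of_lt_one ha0 ha1).mul_left E₁) (fun _ _ _ _ => min_le_left _ _) hΛ hb0 hb

/-! ## §4 The R-branch: the coupling power `R₁ g_j^{κ₀}` under the lower half of (0.31) against `b_j·Λⁿ` -/

/-- **KING's CROSSOVER, R-BRANCH.**  Under the LOWER half of the endpoint running `Step.Discrete031 b₀ β′ K (g K) (gs K)` for every `K`
(`1∕g² + b₀(K−k) ≤ 1∕g_k²`, `b₀ > 0`), nonnegative couplings, `R₁ ≥ 0`, `κ₀ > 2`, `Λ ≥ 0` and a nonnegative profile `b → 0`: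
`Σ_{j+n=K} min(R₁ (gs K j)^{κ₀}, b_jΛⁿ) → 0`.  Dominating sequence `R₁(b₀n)^{−κ₀∕2}` (`T4Crossover.min_le_of_inv_sq_le` with `D = b₀n`, a
p-series for `κ₀ > 2`; the consecutive count `T4Crossover.sum_min_coupling_le` needs `κ₀ > 4`). [cite: Balaban1988Convergent, Thm 2 (2.44) p.263]
[folklore] -/
theorem tendsto_crossoverR_of_profile {b₀ β' R₁ Λ : ℝ} {κ₀ : ℕ} {g : ℕ → ℝ} {gs : ℕ → ℕ → ℝ} {b : ℕ → ℝ}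
    (hb₀ : 0 < b₀) (h031 : ∀ K, Step.Discrete031 b₀ β' K (g K) (gs K)) (hpos : ∀ K k, k ≤ K → 0 ≤ gs K k)
    (hR₁ : 0 ≤ R₁) (hκ : 2 < κ₀) (hΛ : 0 ≤ Λ) (hb0 : ∀ j, 0 ≤ b j) (hb : Tendsto b atTop (𝓝 0)) :
    Tendsto (fun K => ∑ p ∈ antidiagonal K, min (R₁ * gs K p.1 ^ κ₀) (b p.1 * Λ ^ p.2)) atTop (𝓝 0) := by
  refine tendsto_sum_min_of_profile (s := fun K p => R₁ * gs K p.1 ^ κ₀)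
    (c := fun n => R₁ * (b₀ * (n : ℝ))⁻¹ ^ ((κ₀ : ℝ) / 2)) ?_ ?_ ?_ ?_ hΛ hb0 hb
  · intro K p hp
    have hjK : p.1 + p.2 = K := mem_antidiagonal.mp hp
    exact mul_nonneg hR₁ (pow_nonneg (hpos K p.1 (by omega)) _)
  · intro n
    exact mul_nonneg hR₁ (Real.rpow_nonneg (inv_nonneg.mpr (by positivity)) _)
  · -- `R₁ (b₀ n)^{−κ₀/2} = R₁ b₀^{−κ₀/2} · (n^{κ₀/2})⁻¹`, a convergent p-series
    have hp : 1 < (κ₀ : ℝ) / 2 := by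
      have h2 : (2 : ℝ) < κ₀ := by exact_mod_cast hκ
      linarith
    have hs := (Real.summable_nat_rpow_inv.mpr hp).mul_left (R₁ * b₀⁻¹ ^ ((κ₀ : ℝ) / 2))
    refine hs.congr fun n => ?_
    show R₁ * b₀⁻¹ ^ ((κ₀ : ℝ) / 2) * ((n : ℝ) ^ ((κ₀ : ℝ) / 2))⁻¹ = R₁ * (b₀ * (n : ℝ))⁻¹ ^ ((κ₀ : ℝ) / 2)
    rw [mul_inv, Real.mul_rpow (inv_nonneg.mpr hb₀.le) (inv_nonneg.mpr (Nat.cast_nonneg n)),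
      Real.inv_rpow (Nat.cast_nonneg n)]
    ring
  · intro K p hp hn
    have hjK : p.1 + p.2 = K := mem_antidiagonal.mp hp
    have hj : p.1 ≤ K := by omega
    have hn' : (0 : ℝ) < (p.2 : ℝ) := by exact_mod_cast hn
    have hD : 0 < b₀ * (p.2 : ℝ) := mul_pos hb₀ hn'
    have hle : b₀ * (p.2 : ℝ) ≤ 1 / gs K p.1 ^ 2 := by
      have h1 := (h031 K p.1 hj).1
      have hKj : (K : ℝ) - p.1 = p.2 := by
        have : (K : ℝ) = p.1 + p.2 := by rw [← hjK]; push_cast; ring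
        linarith
      rw [hKj] at h1
      have h2 : 0 ≤ 1 / g K ^ 2 := div_nonneg zero_le_one (sq_nonneg _)
      linarith
    exact T4Crossover.min_le_of_inv_sq_le hR₁ (hpos K p.1 hj) hD hle _

/-! ## §5 The King crossover majorant and node U6 -/

section Majorant

variable {E₁ a Λ b₀ β' R₁ : ℝ} {κ₀ : ℕ} {g : ℕ → ℝ} {gs : ℕ → ℕ → ℝ} {b w : ℕ → ℝ}

/-- **THE KING CROSSOVER MAJORANT TENDS TO ZERO.**  E-branch + R-branch + a last-step ∕ weight-class term `w_K → 0` (nodes U5c ∕ NE7b; in the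
consecutive currency `Summable w`): the node-U4′ analogue of `T4Crossover.summable_crossoverDelta` with `θ^j ↦ b_j`, `Summable ↦ → 0`.
[folklore] -/
theorem tendsto_kingCrossover (hE₁ : 0 ≤ E₁) (ha0 : 0 ≤ a) (ha1 : a < 1) (hΛ : 0 ≤ Λ) (hb₀ : 0 < b₀)
    (h031 : ∀ K, Step.Discrete031 b₀ β' K (g K) (gs K)) (hpos : ∀ K k, k ≤ K → 0 ≤ gs K k) (hR₁ : 0 ≤ R₁)
    (hκ : 2 < κ₀) (hb0 : ∀ j, 0 ≤ b j) (hb : Tendsto b atTop (𝓝 0)) (hw : Tendsto w atTop (𝓝 0)) :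
    Tendsto (fun K => (∑ p ∈ antidiagonal K, min (E₁ * a ^ p.2) (b p.1 * Λ ^ p.2))
      + (∑ p ∈ antidiagonal K, min (R₁ * gs K p.1 ^ κ₀) (b p.1 * Λ ^ p.2)) + w K) atTop (𝓝 0) := by
  simpa using ((tendsto_crossoverE_of_profile hE₁ ha0 ha1 hΛ hb0 hb).add
    (tendsto_crossoverR_of_profile hb₀ h031 hpos hR₁ hκ hΛ hb0 hb)).add hw

/-- **NODE U6 FROM NODE U4′ IN KING'S ORGANISATION.**  King's matching shape — for all `K`, `n`, a `t`-free constant `c` with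
`|log Z_{K+n}(t) − log Z_K(t) − c| ≤ vol·(King crossover majorant at K)` on `|t| ≤ l₀` — with the hypotheses of `tendsto_kingCrossover` and
`0 ≤ l₀`: the majorant tends to zero, every `K ↦ genFun Z K t` (`|t| ≤ l₀`) is Cauchy, and the convergence to `genFunLim Z` is uniform on the
closed `l₀`-ball (`DirectPairingCauchy` BY NAME).  Compare `T4Crossover.cauchySum_of_crossover` (consecutive: `MatchingModConstants` +
`Summable crossoverDelta`).  CONDITIONAL kernel theorem; no hypothesis is in print for Bałaban's d = 4 procedure. [cite: King1986, p.657] [folklore] -/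
theorem king_U6_of_crossover {vol l₀ : ℝ} {Z : ℕ → ℝ → ℝ} (hE₁ : 0 ≤ E₁) (ha0 : 0 ≤ a) (ha1 : a < 1) (hΛ : 0 ≤ Λ)
    (hb₀ : 0 < b₀) (h031 : ∀ K, Step.Discrete031 b₀ β' K (g K) (gs K)) (hpos : ∀ K k, k ≤ K → 0 ≤ gs K k)
    (hR₁ : 0 ≤ R₁) (hκ : 2 < κ₀) (hb0 : ∀ j, 0 ≤ b j) (hb : Tendsto b atTop (𝓝 0)) (hw : Tendsto w atTop (𝓝 0))
    (hl₀ : 0 ≤ l₀)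
    (hU5 : ∀ K n : ℕ, ∃ c : ℝ, ∀ t : ℝ, |t| ≤ l₀ →
      |Real.log (Z (K + n) t) - Real.log (Z K t) - c| ≤
        vol * ((∑ p ∈ antidiagonal K, min (E₁ * a ^ p.2) (b p.1 * Λ ^ p.2))
          + (∑ p ∈ antidiagonal K, min (R₁ * gs K p.1 ^ κ₀) (b p.1 * Λ ^ p.2)) + w K)) :
    Tendsto (fun K => (∑ p ∈ antidiagonal K, min (E₁ * a ^ p.2) (b p.1 * Λ ^ p.2))
        + (∑ p ∈ antidiagonal K, min (R₁ * gs K p.1 ^ κ₀) (b p.1 * Λ ^ p.2)) + w K) atTop (𝓝 0) ∧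
      (∀ t : ℝ, |t| ≤ l₀ → CauchySeq fun K => genFun Z K t) ∧
      TendstoUniformlyOn (fun K t => genFun Z K t) (genFunLim Z) atTop {t | |t| ≤ l₀} := by
  have hδ := tendsto_kingCrossover hE₁ ha0 ha1 hΛ hb₀ h031 hpos hR₁ hκ hb0 hb hw
  exact ⟨hδ, fun t ht => cauchySeq_genFun_of_unif hU5 hl₀ hδ ht, tendstoUniformlyOn_genFun_of_unif hU5 hl₀ hδ⟩

end Majorant

/-- **THE E-SIDE PROFILE OF THE CARRIERS FEEDS THE LIVE CROSSOVER, BY NAME.**  Under the hypotheses of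
`TowerCarriersKing.king_U6_of_carriers` (tower-NE5 on the box, prefix dependence, separate uniform continuity per scale uniform over
runs ∕ backgrounds ∕ domains, the (1.18)-type bound, run histories in the box with a summable K-uniform consecutive matching profile — node U2):
the scale profile `b_j → 0` dominating every direct bracket of the carriers makes the King E-branch `Σ_{j+n=K} min(E₁aⁿ, b_jΛⁿ)` tend to zero for
EVERY `E₁ ≥ 0`, `0 ≤ a < 1`, `Λ ≥ 0` — the clause that END stated for the retired `T4CauchySum.delta`, now for node U4′. [folklore] -/
theorem king_crossover_of_carriers (T : TowerData) {E : ℕ → (ℕ → ℝ) → T.B → T.Dom → ℝ} {I : Set ℝ} {κ θ C₅ B : ℝ}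
    {p : ℕ → ℝ} {t : ℕ → ℕ → ℝ} (hC : 0 ≤ C₅) (hθ0 : 0 ≤ θ) (hθ1 : θ < 1) (h5 : TowerNE5On T E I κ θ C₅)
    (hP : ∀ (k : ℕ) (U : T.B) (X : T.Dom), ∀ g ∈ BoxWindow I, ∀ g' ∈ BoxWindow I,
      (∀ i, i < k - T.r X → g i = g' i) → E k g U X = E k g' U X)
    (hUC : ∀ m i : ℕ, i < m → ∀ ε : ℝ, 0 < ε → ∃ δ : ℝ, 0 < δ ∧ ∀ (k : ℕ) (U : T.B) (X : T.Dom), T.r X + m = k →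
      ∀ g ∈ BoxWindow I, ∀ g' ∈ BoxWindow I, (∀ j, j ≠ i → g j = g' j) → |g i - g' i| ≤ δ →
        Real.exp (κ * T.d X) * |E k g U X - E k g' U X| ≤ ε)
    (hB0 : 0 ≤ B) (hB : ∀ (k : ℕ) (U : T.B) (X : T.Dom), ∀ g ∈ BoxWindow I, Real.exp (κ * T.d X) * |E k g U X| ≤ B)
    (ht : ∀ K, t K ∈ BoxWindow I) (hp : ∀ K i, |t (K + 1) (i + 1) - t K i| ≤ p i) (hp0 : ∀ i, 0 ≤ p i)
    (hps : Summable p) :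
    ∃ b : ℕ → ℝ, (∀ j, 0 ≤ b j) ∧ Tendsto b atTop (𝓝 0) ∧
      (∀ (K n : ℕ) (U : T.B) (X : T.Dom), T.r X ≤ K →
        |E (K + n) (t (K + n)) U X - E K (t K) (T.descend (K + n) U K) X| ≤ b (K - T.r X) * Real.exp (-(κ * T.d X))) ∧
      ∀ (E₁ a Λ : ℝ), 0 ≤ E₁ → 0 ≤ a → a < 1 → 0 ≤ Λ →
        Tendsto (fun K => ∑ q ∈ antidiagonal K, min (E₁ * a ^ q.2) (b q.1 * Λ ^ q.2)) atTop (𝓝 0) := by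
  obtain ⟨b, hb0, hb, hdom, -⟩ :=
    TowerCarriersKing.king_U6_of_carriers T hC hθ0 hθ1 h5 hP hUC hB0 hB ht hp hp0 hps
  exact ⟨b, hb0, hb, hdom, fun E₁ a Λ hE₁ ha0 ha1 hΛ => tendsto_crossoverE_of_profile hE₁ ha0 ha1 hΛ hb0 hb⟩

/-! ## §6 Two-sided: the size branch is load-bearing; no summability and no rate are inherited -/

/-- **WITHOUT THE SIZE BRANCH THE ENTROPY WINS.**  Rate × multiplicity alone does not tend to zero under a qualitative profile: with
`b_j = 1∕(j+1) → 0` and `Λ = 2`, `Σ_{j+n=K} b_j·Λⁿ ≥ b_0·2^K = 2^K ≥ 1`, so the sum does NOT tend to zero — the printed one-run size bound is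
LOAD-BEARING for King's currency at node U4′. [folklore] -/
theorem rateOnly_not_tendsto :
    ¬ Tendsto (fun K : ℕ => ∑ p ∈ antidiagonal K, 1 / ((p.1 : ℝ) + 1) * (2 : ℝ) ^ p.2) atTop (𝓝 0) := by
  intro h
  have hge : ∀ K : ℕ, (1 : ℝ) ≤ ∑ p ∈ antidiagonal K, 1 / ((p.1 : ℝ) + 1) * (2 : ℝ) ^ p.2 := by
    intro K
    have hmem : ((0 : ℕ), K) ∈ antidiagonal K := by simp [HasAntidiagonal.mem_antidiagonal]
    have h1 : (1 : ℝ) ≤ 1 / (((0 : ℕ) : ℝ) + 1) * (2 : ℝ) ^ K := by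
      simp only [Nat.cast_zero, zero_add, div_one, one_mul]
      exact one_le_pow₀ (by norm_num)
    refine h1.trans ?_
    exact single_le_sum (f := fun p : ℕ × ℕ => 1 / ((p.1 : ℝ) + 1) * (2 : ℝ) ^ p.2)
      (fun p _ => by positivity) hmem
  have hev := (h.eventually (gt_mem_nhds (show (0 : ℝ) < 1 by norm_num))).exists
  obtain ⟨K, hK⟩ := hev
  exact absurd (hge K) (not_le.mpr hK)

/-- **THE CONSECUTIVE SOCKET IS NOT RECOVERED.**  With the admissible profile `b_j = 1∕(j+1)`, `E₁ = 1`, `a = 1∕2`, `Λ = 1`, the King crossover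
sum is `≥` its `n = 0` term `min(1, 1∕(K+1)) = 1∕(K+1)`, hence NOT summable over `K`: `T4Crossover.summable_crossoverDelta` ∕
`T4CauchySum.cauchySeq_genFun` (the consecutive node U6) do not follow from `b → 0`, while §3 ∕ §5 fire (the sum `→ 0`).  Consistent with
C38e (`DirectPairingApexSharp.alt_strict`). [folklore] -/
theorem crossover_not_summable :
    ¬ Summable (fun K : ℕ => ∑ p ∈ antidiagonal K,
      min ((1 : ℝ) * (1 / 2 : ℝ) ^ p.2) (1 / ((p.1 : ℝ) + 1) * (1 : ℝ) ^ p.2)) := by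
  have hh : ¬ Summable (fun K : ℕ => 1 / ((K : ℝ) + 1)) := by
    intro h
    refine Real.not_summable_one_div_natCast ((summable_nat_add_iff 1).mp ?_)
    simpa [Nat.cast_add, Nat.cast_one] using h
  intro hs
  refine hh (hs.of_nonneg_of_le (fun K => by positivity) fun K => ?_)
  have hmem : (K, (0 : ℕ)) ∈ antidiagonal K := by simp [HasAntidiagonal.mem_antidiagonal]
  have h1 : min ((1 : ℝ) * (1 / 2 : ℝ) ^ (0 : ℕ)) (1 / (((K : ℕ) : ℝ) + 1) * (1 : ℝ) ^ (0 : ℕ)) = 1 / ((K : ℝ) + 1) := by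
    rw [pow_zero, pow_zero, mul_one, mul_one]
    refine min_eq_right ?_
    rw [div_le_one (by positivity)]
    linarith [(Nat.cast_nonneg K : (0 : ℝ) ≤ K)]
  rw [← h1]
  exact single_le_sum (f := fun p : ℕ × ℕ => min ((1 : ℝ) * (1 / 2 : ℝ) ^ p.2) (1 / ((p.1 : ℝ) + 1) * (1 : ℝ) ^ p.2))
    (fun p _ => le_min (by positivity) (by positivity)) hmem

/-- … while for the SAME data King's END fires: the harmonic profile `b_j = 1∕(j+1)` is admissible (nonnegative, `→ 0`:
Mathlib's `tendsto_one_div_add_atTop_nhds_zero_nat`) and the sum tends to zero (§3). [folklore] -/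
theorem crossover_tendsto_harmonic :
    Tendsto (fun K : ℕ => ∑ p ∈ antidiagonal K,
      min ((1 : ℝ) * (1 / 2 : ℝ) ^ p.2) (1 / ((p.1 : ℝ) + 1) * (1 : ℝ) ^ p.2)) atTop (𝓝 0) :=
  tendsto_crossoverE_of_profile (b := fun j => 1 / ((j : ℝ) + 1)) zero_le_one (by norm_num) (by norm_num) zero_le_one
    (fun j => by positivity) tendsto_one_div_add_atTop_nhds_zero_nat

/-- **NO RATE IS INHERITED.**  The King crossover sum dominates its `n = 0` term `min(E₁, b_K)` (`E₁, a, Λ ≥ 0`, `b ≥ 0`): it tends to zero no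
faster than the profile itself. [folklore] -/
theorem profile_le_crossover {E₁ a Λ : ℝ} {b : ℕ → ℝ} (hE₁ : 0 ≤ E₁) (ha0 : 0 ≤ a) (hΛ : 0 ≤ Λ) (hb0 : ∀ j, 0 ≤ b j)
    (K : ℕ) : min E₁ (b K) ≤ ∑ p ∈ antidiagonal K, min (E₁ * a ^ p.2) (b p.1 * Λ ^ p.2) := by
  have hmem : (K, (0 : ℕ)) ∈ antidiagonal K := by simp [HasAntidiagonal.mem_antidiagonal]
  have h1 : min E₁ (b K) = min (E₁ * a ^ (0 : ℕ)) (b K * Λ ^ (0 : ℕ)) := by simp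
  rw [h1]
  exact single_le_sum (f := fun p : ℕ × ℕ => min (E₁ * a ^ p.2) (b p.1 * Λ ^ p.2))
    (fun p _ => le_min (mul_nonneg hE₁ (pow_nonneg ha0 _)) (mul_nonneg (hb0 _) (pow_nonneg hΛ _))) hmem

end Summit.QuantumFields.BalabanUV.T4Continuum.NE9.DirectPairingCrossover
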